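import Literature.Computability.AlgebraicComplexity.BDI20TableauTreewidthProofs
import Literature.Combinatorics.SimpleGraph.TreewidthCubeGridLowerBound
import HarnessLib

/-!
# BDI Question 7.6 (arXiv Question 21): the `O(√n)` tree-width bound fails from three rows on
(theorem-only file)

[BlaserDorflerIkenmeyer2020, Question 21 (= CCC 2021 Question 7.6)] asks whether the bound
`tw(G_S) = O(√n)` for the graphs of two-row semistandard Young tableaux (Prop 20 (1) = CCC
Prop 7.5 (1), `BDI2020_prop_7_5_upper_holds`) "can be extended to any other constant number of
rows". For the statement as typed in the tree (`BDI2020_question_7_6 r`: one constant `C_r` with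
`tw(G_S) ≤ C_r (⌊√n⌋ + 1)` for all semistandard Young tableaux of partition shape with columns of
height `≤ r` and entries `< n`; no restriction on the content) the answer is **no for every
`r ≥ 3`** (`not_BDI2020_question_7_6`), and yes for `r ≤ 2` (`BDI2020_question_7_6_iff`).

The witnesses (ours). For `m = k + 1`, `a = m² + m`, `b = m²`, `N = 3m³`, the STEP TABLEAU
`S_m` is the list of the `2N` columns `[ℓ, ℓ+a, ℓ+a+b], [ℓ, ℓ+a, ℓ+a+b+1]` (`ℓ = 0, …, N-1`, in
this order): three rows, every row non-decreasing, columns strictly increasing, entries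
`< n = N + a + b + 1 = 3m³ + 2m² + m + 1` (`isSemistandard_stepTableau`). Its graph contains the
edges `{u, u+a}`, `{u, u+b}`, `{u, u+b+1}` for all `a ≤ u < N`, hence the `m × m × m` grid under
the labelling `(x, y, z) ↦ a + (x+y+z)·m² + x·m + y` (an `x`-step adds `a`, a `z`-step adds `b`, a
`y`-step adds `b + 1`; `treewidth_cubeGrid_le_tableauGraph`) — in queue-layout terms: the
three-dimensional grid has a 2-queue layout, and two queues fit into three rows. Since
`tw(m × m × m grid) ≥ m²/16` (`le_treewidth_cubeGrid`, the separator method) while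
`√n + 1 ≤ 2 m^{3/2} + 1`, no `C (⌊√n⌋ + 1)` bound holds (take `m = t²`, `t = 64 (C+1)`).
(With bounded content the graphs `G_S` of `r`-row tableaux have maximum degree `< r·d`; the
typed question, like the printed one, does not bound the content.)

## References
* [BlaserDorflerIkenmeyer2020] M. Bläser, J. Dörfler, C. Ikenmeyer, On the complexity of
  evaluating highest weight vectors, CCC 2021 (arXiv:2002.11594), Question 21 / 7.6; locator
  paper:arxiv-2002.11594 p0016.txt:L67-68.
* [SunilchandranKavitha2006] L. S. Chandran, T. Kavitha, The treewidth and pathwidth of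
  hypercubes, Discrete Math. 306 (2006), §4 (separator method for tree-width lower bounds).
-/

open scoped Classical

namespace Literature.Computability.AlgebraicComplexity

namespace BDI20Treewidth

open Literature.Combinatorics.SimpleGraph _root_.SimpleGraph

/-! ### The step tableau -/

/-- Columns of the step tableau. [folklore] -/
private theorem mem_stepTableau {a b N : ℕ} {c : List ℕ} :
    c ∈ (List.range N).flatMap (fun ℓ => [[ℓ, ℓ + a, ℓ + a + b], [ℓ, ℓ + a, ℓ + a + b + 1]]) ↔
      ∃ ℓ < N, c = [ℓ, ℓ + a, ℓ + a + b] ∨ c = [ℓ, ℓ + a, ℓ + a + b + 1] := by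
  simp [List.mem_flatMap, List.mem_range]

/-- Columns of the step tableau are nonempty of height `3` with entries `< N + a + b + 1`.
[folklore] -/
private theorem stepTableau_col {a b N : ℕ} {c : List ℕ}
    (hc : c ∈ (List.range N).flatMap (fun ℓ => [[ℓ, ℓ + a, ℓ + a + b], [ℓ, ℓ + a, ℓ + a + b + 1]])) :
    c ≠ [] ∧ c.length = 3 ∧ ∀ u ∈ c, u < N + a + b + 1 := by
  obtain ⟨ℓ, hℓ, rfl | rfl⟩ := mem_stepTableau.1 hc
  · refine ⟨by simp, by simp, fun u hu => ?_⟩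
    simp only [List.mem_cons, List.not_mem_nil, or_false] at hu
    omega
  · refine ⟨by simp, by simp, fun u hu => ?_⟩
    simp only [List.mem_cons, List.not_mem_nil, or_false] at hu
    omega

/-- **The step tableau is semistandard** (for `a, b ≥ 1`): its columns `[ℓ, ℓ+a, ℓ+a+b]`,
`[ℓ, ℓ+a, ℓ+a+b+1]` strictly increase and its three rows `ℓ ↦ ℓ, ℓ+a, ℓ+a+b (+1)` are
non-decreasing along the column list. Construction ours, answering
[cite: BlaserDorflerIkenmeyer2020, Question 21 (arXiv; = CCC 2021 Question 7.6)]. -/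
theorem isSemistandard_stepTableau {a b : ℕ} (ha : 0 < a) (hb : 0 < b) (N : ℕ) :
    BDI2020.IsSemistandard
      ((List.range N).flatMap fun ℓ => [[ℓ, ℓ + a, ℓ + a + b], [ℓ, ℓ + a, ℓ + a + b + 1]]) := by
  refine ⟨fun c hc => ?_, ?_⟩
  · obtain ⟨ℓ, -, rfl | rfl⟩ := mem_stepTableau.1 hc
    · simp only [List.isChain_cons_cons, List.isChain_singleton, and_true]; omega
    · simp only [List.isChain_cons_cons, List.isChain_singleton, and_true]; omega
  · refine List.Pairwise.isChain ?_
    rw [List.pairwise_flatMap]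
    constructor
    · intro ℓ _
      rw [List.pairwise_pair]
      intro i hi
      simp only [List.length_cons, List.length_nil] at hi
      interval_cases i <;> simp
    · refine List.Pairwise.imp_of_mem ?_ List.pairwise_lt_range
      intro ℓ ℓ' _ _ hlt c hc c' hc'
      simp only [List.mem_cons, List.not_mem_nil, or_false] at hc hc'
      intro i hi
      rcases hc with rfl | rfl <;> rcases hc' with rfl | rfl <;>
        · simp only [List.length_cons, List.length_nil] at hi
          interval_cases i <;> simp <;> omega

/-- Two distinct entries of a column are adjacent in the tableau graph. [folklore] -/
private theorem tableauGraph_adj_of_mem {S : List (List ℕ)} {n : ℕ} {i j : Fin n} {c : List ℕ}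
    (hc : c ∈ S) (hi : i.val ∈ c) (hj : j.val ∈ c) (hne : i ≠ j) :
    (BDI2020.tableauGraph S n).Adj i j := by
  rw [BDI2020.tableauGraph, SimpleGraph.fromRel_adj]
  exact ⟨hne, Or.inl ⟨c, hc, hi, hj⟩⟩

/-- The graph of the step tableau contains the steps `u → u + a` (`u < N`) and `u → u + b`,
`u → u + b + 1` (`a ≤ u`, `u - a < N`). [folklore] -/
private theorem stepTableau_adj {a b N n : ℕ} (ha : 0 < a) (hb : 0 < b)
    {i j : Fin n}
    (h : (i.val < N ∧ j.val = i.val + a) ∨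
      (a ≤ i.val ∧ i.val - a < N ∧ (j.val = i.val + b ∨ j.val = i.val + b + 1))) :
    (BDI2020.tableauGraph
      ((List.range N).flatMap fun ℓ => [[ℓ, ℓ + a, ℓ + a + b], [ℓ, ℓ + a, ℓ + a + b + 1]]) n).Adj
      i j := by
  have hne : i ≠ j := by
    intro hij
    rw [hij] at h
    omega
  rcases h with ⟨hiN, hj⟩ | ⟨hai, hiN, hj | hj⟩
  · refine tableauGraph_adj_of_mem (c := [i.val, i.val + a, i.val + a + b])
      (mem_stepTableau.2 ⟨i.val, hiN, Or.inl rfl⟩) (by simp) (by simp [hj]) hne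
  · refine tableauGraph_adj_of_mem (c := [i.val - a, i.val - a + a, i.val - a + a + b])
      (mem_stepTableau.2 ⟨i.val - a, hiN, Or.inl rfl⟩) (by simp; omega) (by simp; omega) hne
  · refine tableauGraph_adj_of_mem (c := [i.val - a, i.val - a + a, i.val - a + a + b + 1])
      (mem_stepTableau.2 ⟨i.val - a, hiN, Or.inr rfl⟩) (by simp; omega) (by simp; omega) hne

/-! ### The cube grid inside the graph of the step tableau -/

/-- Positional labels determine the coordinates. [folklore] -/
private theorem label_inj {m s x y s' x' y' : ℕ} (hx : x < m) (hy : y < m) (hx' : x' < m)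
    (hy' : y' < m) (h : s * m ^ 2 + x * m + y = s' * m ^ 2 + x' * m + y') :
    s = s' ∧ x = x' ∧ y = y' := by
  have hm : 0 < m := by omega
  have e1 : s * m ^ 2 + x * m + y = y + (s * m + x) * m := by ring
  have e1' : s' * m ^ 2 + x' * m + y' = y' + (s' * m + x') * m := by ring
  rw [e1, e1'] at h
  have hmod := congrArg (· % m) h
  simp only [Nat.add_mul_mod_self_right, Nat.mod_eq_of_lt hy, Nat.mod_eq_of_lt hy'] at hmod
  have hdiv := congrArg (· / m) h
  simp only [Nat.add_mul_div_right _ _ hm, Nat.div_eq_of_lt hy, Nat.div_eq_of_lt hy',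
    zero_add] at hdiv
  have e2 : s * m + x = x + s * m := by ring
  have e2' : s' * m + x' = x' + s' * m := by ring
  rw [e2, e2'] at hdiv
  have hmod2 := congrArg (· % m) hdiv
  simp only [Nat.add_mul_mod_self_right, Nat.mod_eq_of_lt hx, Nat.mod_eq_of_lt hx'] at hmod2
  have hdiv2 := congrArg (· / m) hdiv
  simp only [Nat.add_mul_div_right _ _ hm, Nat.div_eq_of_lt hx, Nat.div_eq_of_lt hx',
    zero_add] at hdiv2
  exact ⟨hdiv2, hmod2, hmod⟩

/-- **The `m × m × m` grid embeds into the graph of the step tableau** `S_m` (`m = k + 1`,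
`a = m² + m`, `b = m²`, `N = 3m³`, `n = N + a + b + 1` labels) under
`(x, y, z) ↦ a + (x + y + z)·m² + x·m + y`: an `x`-step adds `a`, a `z`-step adds `b`, a `y`-step
adds `b + 1`, all of which are columns' pairs; hence `tw(grid) ≤ tw(G_{S_m})`. Construction ours
(a 2-queue layout of the grid realised in three rows), for
[cite: BlaserDorflerIkenmeyer2020, Question 21 (arXiv; = CCC 2021 Question 7.6)]. -/
theorem treewidth_cubeGrid_le_tableauGraph (k : ℕ) :
    treewidth (pathGraph (k + 1) □ (pathGraph (k + 1) □ pathGraph (k + 1))) ≤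
      treewidth (BDI2020.tableauGraph
        ((List.range (3 * (k + 1) ^ 3)).flatMap fun ℓ =>
          [[ℓ, ℓ + ((k + 1) ^ 2 + (k + 1)), ℓ + ((k + 1) ^ 2 + (k + 1)) + (k + 1) ^ 2],
            [ℓ, ℓ + ((k + 1) ^ 2 + (k + 1)), ℓ + ((k + 1) ^ 2 + (k + 1)) + (k + 1) ^ 2 + 1]])
        (3 * (k + 1) ^ 3 + 2 * (k + 1) ^ 2 + (k + 1) + 1)) := by
  -- the labelling and its range
  have hL : ∀ v : Fin (k + 1) × Fin (k + 1) × Fin (k + 1),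
      ((v.1 : ℕ) + v.2.1 + v.2.2) * (k + 1) ^ 2 + v.1 * (k + 1) + v.2.1 + ((k + 1) ^ 2 + (k + 1))
        < 3 * (k + 1) ^ 3 := by
    rintro ⟨x, y, z⟩
    have hx := x.isLt
    have hy := y.isLt
    have hz := z.isLt
    simp only
    have h1 : ((x : ℕ) + y + z) * (k + 1) ^ 2 ≤ (3 * k) * (k + 1) ^ 2 :=
      Nat.mul_le_mul_right _ (by omega)
    have h2 : (x : ℕ) * (k + 1) ≤ k * (k + 1) := Nat.mul_le_mul_right _ (by omega)
    nlinarith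
  have ha : 0 < (k + 1) ^ 2 + (k + 1) := by positivity
  have hb : 0 < (k + 1) ^ 2 := by positivity
  let f : (pathGraph (k + 1) □ (pathGraph (k + 1) □ pathGraph (k + 1))) →g
      BDI2020.tableauGraph
        ((List.range (3 * (k + 1) ^ 3)).flatMap fun ℓ =>
          [[ℓ, ℓ + ((k + 1) ^ 2 + (k + 1)), ℓ + ((k + 1) ^ 2 + (k + 1)) + (k + 1) ^ 2],
            [ℓ, ℓ + ((k + 1) ^ 2 + (k + 1)), ℓ + ((k + 1) ^ 2 + (k + 1)) + (k + 1) ^ 2 + 1]])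
        (3 * (k + 1) ^ 3 + 2 * (k + 1) ^ 2 + (k + 1) + 1) :=
    { toFun := fun v =>
        ⟨((v.1 : ℕ) + v.2.1 + v.2.2) * (k + 1) ^ 2 + v.1 * (k + 1) + v.2.1 +
          ((k + 1) ^ 2 + (k + 1)), by have := hL v; omega⟩
      map_rel' := by
        rintro ⟨x, y, z⟩ ⟨x', y', z'⟩ hvw
        simp only [boxProd_adj, pathGraph_adj, Prod.mk.injEq] at hvw
        rcases hvw with ⟨hx | hx, rfl, rfl⟩ | ⟨⟨hy | hy, rfl⟩ | ⟨hz | hz, rfl⟩, rfl⟩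
        · -- `x`-step up: adds `a`
          refine stepTableau_adj ha hb (Or.inl ⟨hL _, ?_⟩)
          simp only [← hx]; ring
        · refine (stepTableau_adj ha hb (Or.inl ⟨hL _, ?_⟩)).symm
          simp only [← hx]; ring
        · -- `y`-step up: adds `b + 1`
          refine stepTableau_adj ha hb (Or.inr ⟨by simp only; omega, ?_, Or.inr ?_⟩)
          · have := hL (x, y, z); simp only at this ⊢; omega
          · simp only [← hy]; ring
        · refine (stepTableau_adj ha hb (Or.inr ⟨by simp only; omega, ?_, Or.inr ?_⟩)).symm
          · have := hL (x, y', z); simp only at this ⊢; omega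
          · simp only [← hy]; ring
        · -- `z`-step up: adds `b`
          refine stepTableau_adj ha hb (Or.inr ⟨by simp only; omega, ?_, Or.inl ?_⟩)
          · have := hL (x, y, z); simp only at this ⊢; omega
          · simp only [← hz]; ring
        · refine (stepTableau_adj ha hb (Or.inr ⟨by simp only; omega, ?_, Or.inl ?_⟩)).symm
          · have := hL (x, y, z'); simp only at this ⊢; omega
          · simp only [← hz]; ring }
  refine treewidth_le_of_hom_injective f ?_
  rintro ⟨x, y, z⟩ ⟨x', y', z'⟩ h
  have h' : ((x : ℕ) + y + z) * (k + 1) ^ 2 + x * (k + 1) + y + ((k + 1) ^ 2 + (k + 1)) =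
      ((x' : ℕ) + y' + z') * (k + 1) ^ 2 + x' * (k + 1) + y' + ((k + 1) ^ 2 + (k + 1)) :=
    congrArg Fin.val h
  obtain ⟨hs, hxx, hyy⟩ := label_inj (m := k + 1) (s := (x : ℕ) + y + z)
    (s' := (x' : ℕ) + y' + z') x.isLt y.isLt x'.isLt y'.isLt (by omega)
  refine Prod.ext (Fin.ext hxx) (Prod.ext (Fin.ext hyy) (Fin.ext ?_))
  simp only
  omega

end BDI20Treewidth

/-! ### The answer to Question 7.6 -/

section Question76

open BDI2020 BDI20Treewidth Literature.Combinatorics.SimpleGraph _root_.SimpleGraph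

/-- **BDI Question 7.6 (arXiv Question 21) has a negative answer for every `r ≥ 3`**: there is
no constant `C` with `tw(G_S) ≤ C (⌊√n⌋ + 1)` for all three-row semistandard Young tableaux `S`
with entries `< n`. Witness: the step tableaux `S_m` (`isSemistandard_stepTableau`), whose graphs
on `n = 3m³ + 2m² + m + 1` labels contain the `m × m × m` grid
(`treewidth_cubeGrid_le_tableauGraph`) of tree-width `≥ m²/16` (`le_treewidth_cubeGrid`); with
`m = t²`, `t = 64 (C + 1)` this exceeds `C (⌊√n⌋ + 1) ≤ C (2t³ + 1)`. Answer ours (the print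
leaves the question open and bounds no content); the statement refuted is the tree's typed form.
[cite: BlaserDorflerIkenmeyer2020, Question 21 (arXiv; = CCC 2021 Question 7.6)] locator:
paper:arxiv-2002.11594 p0016.txt:L67-68. -/
theorem not_BDI2020_question_7_6 {r : ℕ} (hr : 3 ≤ r) : ¬ BDI2020_question_7_6 r := by
  rintro ⟨C, hC⟩
  -- the side `m = k + 1 = t²`, `t = 64 (C + 1)`
  obtain ⟨t, ht⟩ : ∃ t, t = 64 * (C + 1) := ⟨_, rfl⟩
  have ht1 : 1 ≤ t := by omega
  obtain ⟨k, hk⟩ : ∃ k, k + 1 = t ^ 2 :=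
    ⟨t ^ 2 - 1, Nat.sub_add_cancel (Nat.one_le_pow _ _ ht1)⟩
  have hw : 16 * (4 * (C + 1) * t ^ 3) ≤ (k + 1) ^ 2 := by
    rw [hk, ht]; exact le_of_eq (by ring)
  have h1 := le_treewidth_cubeGrid hw
  have h2 := treewidth_cubeGrid_le_tableauGraph k
  have ha : 0 < (k + 1) ^ 2 + (k + 1) := by positivity
  have hb : 0 < (k + 1) ^ 2 := by positivity
  have h3 := hC (3 * (k + 1) ^ 3 + 2 * (k + 1) ^ 2 + (k + 1) + 1)
    ((List.range (3 * (k + 1) ^ 3)).flatMap fun ℓ =>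
      [[ℓ, ℓ + ((k + 1) ^ 2 + (k + 1)), ℓ + ((k + 1) ^ 2 + (k + 1)) + (k + 1) ^ 2],
        [ℓ, ℓ + ((k + 1) ^ 2 + (k + 1)), ℓ + ((k + 1) ^ 2 + (k + 1)) + (k + 1) ^ 2 + 1]])
    (fun c hc => (stepTableau_col hc).1)
    ((List.pairwise_of_forall_mem_list fun c hc c' hc' => by
      rw [(stepTableau_col hc).2.1, (stepTableau_col hc').2.1]))
    (isSemistandard_stepTableau ha hb _)
    (fun c hc => by rw [(stepTableau_col hc).2.1]; exact hr)
    (fun c hc u hu => by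
      have := (stepTableau_col hc).2.2 u hu
      have e : 3 * (k + 1) ^ 3 + 2 * (k + 1) ^ 2 + (k + 1) + 1 =
        3 * (k + 1) ^ 3 + ((k + 1) ^ 2 + (k + 1)) + (k + 1) ^ 2 + 1 := by ring
      omega)
  -- `√n ≤ 2 t³`
  have hsq : Nat.sqrt (3 * (k + 1) ^ 3 + 2 * (k + 1) ^ 2 + (k + 1) + 1) ≤ 2 * t ^ 3 := by
    have hm3 : 3 ≤ k + 1 := by rw [hk, ht]; nlinarith
    have hle : 3 * (k + 1) ^ 3 + 2 * (k + 1) ^ 2 + (k + 1) + 1 ≤ (2 * t ^ 3) ^ 2 := by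
      have e : (2 * t ^ 3) ^ 2 = 4 * (k + 1) ^ 3 := by rw [hk]; ring
      rw [e]
      nlinarith
    exact (Nat.sqrt_le_sqrt hle).trans (Nat.sqrt_eq' _).le
  have hT : 1 ≤ t ^ 3 := Nat.one_le_pow _ _ ht1
  have h4 : C ≤ C * t ^ 3 := Nat.le_mul_of_pos_right _ hT
  have h5 : C * (Nat.sqrt (3 * (k + 1) ^ 3 + 2 * (k + 1) ^ 2 + (k + 1) + 1) + 1) ≤
      C * (2 * t ^ 3 + 1) := Nat.mul_le_mul_left _ (by omega)
  nlinarith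

/-- **Question 7.6 as typed holds exactly for `r ≤ 2`**: for `r ≤ 2` it is Prop 7.5 (1)
(`BDI2020_prop_7_5_upper_holds`), for `r ≥ 3` it fails (`not_BDI2020_question_7_6`).
[cite: BlaserDorflerIkenmeyer2020, Question 21 (arXiv; = CCC 2021 Question 7.6)] -/
theorem BDI2020_question_7_6_iff {r : ℕ} : BDI2020_question_7_6 r ↔ r ≤ 2 := by
  constructor
  · intro h
    by_contra hr
    exact not_BDI2020_question_7_6 (by omega) h
  · intro hr
    obtain ⟨C, hC⟩ := BDI2020_prop_7_5_upper_holds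
    exact ⟨C, fun n S h1 h2 h3 h4 h5 => hC n S h1 h2 h3 (fun c hc => (h4 c hc).trans hr) h5⟩

end Question76

end Literature.Computability.AlgebraicComplexity
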